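import Summits.ResolutionOfSingularities.ResolutionOfSingularities.Theorems.FrobeniusLadderFRationalResolutionFixedPointChartLogRegular
import Summits.ResolutionOfSingularities.ResolutionOfSingularities.Theorems.FrobeniusLadderFRationalResolutionFixedPointGenerators
import Summits.ResolutionOfSingularities.ResolutionOfSingularities.Theorems.FrobeniusLadderFRationalResolutionFixedPointMonomialNhd
import Summits.ResolutionOfSingularities.ResolutionOfSingularities.Theorems.FrobeniusLadderFRationalResolutionFixedPointContraction
import Summits.ResolutionOfSingularities.ResolutionOfSingularities.Theorems.FrobeniusLadderFRationalResolutionFixedPointSaturation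
import Summits.ResolutionOfSingularities.ResolutionOfSingularities.Theorems.FrobeniusLadderFRationalResolutionRsopStrataNhd
import Summits.ResolutionOfSingularities.ResolutionOfSingularities.Theorems.FrobeniusLadderFRationalResolutionGoingUpHeight
import Summits.ResolutionOfSingularities.ResolutionOfSingularities.Theorems.FrobeniusLadderFRationalResolutionFixedPointLogRegular
import HarnessLib

/-!
# Crux `FrobeniusLadder.FRationalResolution` (stmt-ResolutionOfSingularities-15317), line `redirect`,
# stub `stub_diagonalizableQuotientResolution` — **the quotient chart `Spec S₀` is Kato-log-regular on
# a whole Zariski neighbourhood of every `D(A)`-fixed point** (openness of log-regularity, Kato (7.1),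
# proved directly for the fixed-point monomial chart; every field, tame or wild)

`S` a REGULAR algebra of finite type over a field `k`, graded by a torsion abelian group `A`
(`S₀ = 𝒮 0`), `𝔔 ⊇ S_a` (`a ≠ 0`) a prime (a fixed point of `D(A)` on `Spec S`), `𝔮 = 𝔔 ∩ S₀`.
`…FixedPointLogRegular` proved Kato's (2.1) for the monomial chart
`φ : P = {m ∈ ℤⁿ_{≥0} : Σ mᵢaᵢ = 0} → S₀`, `m ↦ x^m` (`x` a homogeneous regular system of parameters at
`𝔔`) AT `𝔮`. Here: there is `g ∈ S₀ ∖ 𝔮` such that (2.1) holds at EVERY prime `𝔮' ∌ g` of `S₀`.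

Assembly of the landed route (memo MEMO-15317-leafhand2-g3 §6–§9): the snc neighbourhood of the
r.s.o.p. (`…RsopStrataNhd`), saturated to a degree-zero basic open (`…FixedPointSaturation`); the
monomial generation `g • S ⊆ S₀[x]` (`…FixedPointMonomialNhd`) and the contraction property
(`…FixedPointContraction`) near `𝔔`; for `𝔮' ∌ g` a prime `𝔔'` of `S` over `𝔮'` of the same local
dimension (`…GoingUpHeight`); and the single-prime packaging
`…FixedPointChartLogRegular.isLogRegularAt_chart_of_stratum`.

* `length_filter_ofFn`, `ofList_filter_ofFn_eq` — list/finset bookkeeping for the stratum `{i : xᵢ ∈ 𝔔'}`;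
* `isRsopPart_of_span_eq` — a generating set of `𝔪` of cardinality `dim` is an r.s.o.p.;
* **`exists_nhd_isLogRegularAt_of_fixed`** — the theorem.

Honest label: MILESTONE of the fixed-point route (Kato (7.1) at fixed points, all fields); the stub
itself (Bergh–Rydh) is not closed. No definitions, no named facts, no sorry.
[cite: Kato1994, Def. (2.1), Prop. (7.1)] [cite: Matsumura1987, Thms. 14.2, 23.7]
-/

noncomputable section

-- single-problem summit: the doubled namespace component is forced
set_option linter.dupNamespace false

open IsLocalRing Literature.AlgebraicGeometry.Resolution
open Literature.AlgebraicGeometry.Resolution.DiagonalizableQuotient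

namespace Summit.ResolutionOfSingularities.ResolutionOfSingularities.Theorems.FRationalResolution.FixedPointLogRegularNhd

universe u w

/-! ## Bookkeeping -/

/-- The number of members of `(f 0, …, f (n-1))` satisfying `p` is the number of indices `i` with
`p (f i)`. [folklore] -/
theorem length_filter_ofFn {α : Type*} (p : α → Prop) [DecidablePred p] :
    ∀ {n : ℕ} (f : Fin n → α),
      ((List.ofFn f).filter (fun y => decide (p y))).length =
        (Finset.univ.filter (fun i => p (f i))).card
  | 0, f => by simp
  | n + 1, f => by
      have ih := length_filter_ofFn p (fun i => f i.succ)
      rw [Finset.card_filter, Fin.sum_univ_succ, ← Finset.card_filter, ← ih, List.ofFn_succ,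
        List.filter_cons]
      by_cases h : p (f 0)
      · simp [h, add_comm]
      · simp [h]

/-- The ideal of the sub-list of `(x 0, …, x (n-1))` lying in `𝔔'` is the stratum ideal
`(xᵢ : xᵢ ∈ 𝔔')`. [folklore] -/
theorem ofList_filter_ofFn_eq {S : Type u} [CommRing S] {n : ℕ} (x : Fin n → S) (𝔔' : Ideal S)
    [DecidablePred (· ∈ 𝔔')] (I : Finset (Fin n)) (hI : ∀ i, i ∈ I ↔ x i ∈ 𝔔') :
    Ideal.ofList ((List.ofFn x).filter (fun y => decide (y ∈ 𝔔'))) =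
      Ideal.span (x '' (↑I : Set (Fin n))) := by
  change Ideal.span _ = _
  congr 1
  ext y
  simp only [Set.mem_setOf_eq, List.mem_filter, List.mem_ofFn', Set.mem_range,
    decide_eq_true_eq, Set.mem_image, Finset.mem_coe]
  constructor
  · rintro ⟨⟨i, rfl⟩, hy⟩
    exact ⟨i, (hI i).mpr hy, rfl⟩
  · rintro ⟨i, hi, rfl⟩
    exact ⟨⟨i, rfl⟩, (hI i).mp hi⟩

/-- A generating family of the maximal ideal of a regular local ring indexed by `Fin n`,
`n = dim R`, is a (full) regular system of parameters in the sense of `IsRsopPart`. [folklore] -/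
theorem isRsopPart_of_span_eq {R : Type u} [CommRing R] [IsRegularLocalRing R] {n : ℕ}
    (z : Fin n → R) (hspan : Ideal.span (Set.range z) = maximalIdeal R)
    (hdim : ringKrullDim R = n) : IsRsopPart z := by
  refine ⟨inferInstance, 0, Fin.elim0, by rw [hdim, Nat.add_zero], ?_⟩
  have h : Set.range (Fin.elim0 : Fin 0 → R) = ∅ := Set.range_eq_empty _
  rw [h, Set.union_empty, hspan]

variable {k : Type u} [Field k] {A : Type w} [DecidableEq A] [AddCommGroup A] {S : Type u}
  [CommRing S] [Algebra k S] (𝒮 : A → Submodule k S) [GradedAlgebra 𝒮]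

/-- **The quotient chart is Kato-log-regular on a neighbourhood of every fixed point.** `S` regular
of finite type over a field, graded by a torsion group; `𝔔` a prime containing every `S_a`, `a ≠ 0`.
There are homogeneous `x₁,…,x_n ∈ 𝔔` (`n = dim S_𝔔`) of degrees `aᵢ` and `g ∈ S₀ ∖ 𝔔` such that,
for the monoid `P = {m ∈ ℤⁿ : m ≥ 0, Σ mᵢ aᵢ = 0}` and the chart `φ(m) = x^m ∈ S₀`, Kato's
condition (2.1) holds at EVERY prime `𝔮'` of `S₀` not containing `g`:
`LogChart.IsLogRegularAt P φ 𝔮'`. [cite: Kato1994, Def. (2.1), Prop. (7.1)] -/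
theorem exists_nhd_isLogRegularAt_of_fixed [IsRegularRing S] [Algebra.FiniteType k S]
    (hA : AddMonoid.IsTorsion A) (𝔔 : Ideal S) [𝔔.IsPrime]
    (hfix : ∀ a : A, a ≠ 0 → ∀ s ∈ 𝒮 a, s ∈ 𝔔) :
    ∃ (n : ℕ) (x : Fin n → S) (a : Fin n → A),
      (∀ i, x i ∈ 𝔔 ∧ x i ∈ 𝒮 (a i)) ∧ (n : WithBot ℕ∞) = ringKrullDim (Localization.AtPrime 𝔔) ∧
      ∃ φ : Multiplicative ↥(AddSubmonoid.nonneg (Fin n → ℤ) ⊓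
          AddMonoidHom.mker (Fintype.linearCombination ℤ a).toAddMonoidHom) →* 𝒮 0,
        (∀ p, ((φ (Multiplicative.ofAdd p) : 𝒮 0) : S) = ∏ i, x i ^ ((p : Fin n → ℤ) i).toNat) ∧
        ∃ g : 𝒮 0, (g : S) ∉ 𝔔 ∧ ∀ (𝔮' : Ideal (𝒮 0)) [𝔮'.IsPrime], g ∉ 𝔮' →
          LogChart.IsLogRegularAt _ φ 𝔮' := by
  classical
  haveI : IsNoetherianRing (𝒮 0) := isNoetherianRing_gradeZero 𝒮 hA
  haveI : Algebra.IsIntegral (𝒮 0) S := algebra_isIntegral 𝒮 hA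
  -- brick 1: a homogeneous regular system of parameters
  obtain ⟨t, hthom, htspan, htcard⟩ :=
    FixedPointGenerators.exists_homogeneous_regularParameters_of_fixed 𝒮 𝔔 hfix
  set n := t.card with hn
  let x : Fin n → S := fun i => (t.equivFin.symm i : S)
  choose a ha using fun i : Fin n => (hthom _ (t.equivFin.symm i).2).2
  have hx𝔔 : ∀ i, x i ∈ 𝔔 := fun i => (hthom _ (t.equivFin.symm i).2).1
  refine ⟨n, x, a, fun i => ⟨hx𝔔 i, ha i⟩, htcard, ?_⟩
  -- the chart (as in `…FixedPointLogRegular`)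
  set P : AddSubmonoid (Fin n → ℤ) := AddSubmonoid.nonneg (Fin n → ℤ) ⊓
    AddMonoidHom.mker (Fintype.linearCombination ℤ a).toAddMonoidHom with hP
  have hPnonneg : ∀ p : P, (0 : Fin n → ℤ) ≤ (p : Fin n → ℤ) := fun p =>
    (AddSubmonoid.mem_nonneg.mp (AddSubmonoid.mem_inf.mp p.2).1)
  have hPdeg : ∀ p : P, Fintype.linearCombination ℤ a (p : Fin n → ℤ) = 0 := fun p =>
    (AddMonoidHom.mem_mker).mp (AddSubmonoid.mem_inf.mp p.2).2
  have hmem : ∀ p : P, ∏ i, x i ^ ((p : Fin n → ℤ) i).toNat ∈ 𝒮 0 := fun p => by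
    have h := FixedPointLogRegular.prod_pow_toNat_mem 𝒮 x a ha (p : Fin n → ℤ) (hPnonneg p)
    rwa [hPdeg p] at h
  let φ : Multiplicative P →* 𝒮 0 :=
    { toFun := fun p => ⟨∏ i, x i ^ ((p.toAdd : Fin n → ℤ) i).toNat, hmem p.toAdd⟩
      map_one' := Subtype.ext (by simp)
      map_mul' := fun p q => Subtype.ext (by
        change ∏ i, x i ^ (((p.toAdd : Fin n → ℤ) + (q.toAdd : Fin n → ℤ)) i).toNat =
          (∏ i, x i ^ ((p.toAdd : Fin n → ℤ) i).toNat) * ∏ i, x i ^ ((q.toAdd : Fin n → ℤ) i).toNat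
        rw [← Finset.prod_mul_distrib]
        refine Finset.prod_congr rfl fun i _ => ?_
        rw [← pow_add, Pi.add_apply, Int.toNat_add (hPnonneg p.toAdd i) (hPnonneg q.toAdd i)]) }
  have hφ : ∀ p : P, ((φ (Multiplicative.ofAdd p) : 𝒮 0) : S) = ∏ i, x i ^ ((p : Fin n → ℤ) i).toNat :=
    fun p => rfl
  refine ⟨φ, hφ, ?_⟩
  -- `range x = ↑t`
  have hrange : (↑t : Set S) = Set.range x := by
    ext s
    constructor
    · intro hs
      exact ⟨t.equivFin ⟨s, hs⟩, by simp [x]⟩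
    · rintro ⟨i, rfl⟩
      exact (t.equivFin.symm i).2
  have hspan : Ideal.span (algebraMap S (Localization.AtPrime 𝔔) '' Set.range x) =
      maximalIdeal (Localization.AtPrime 𝔔) := by rw [← hrange, htspan]
  -- brick 2: the snc neighbourhood of the r.s.o.p.
  have hrsop : IsRsopPart fun i => algebraMap S (Localization.AtPrime 𝔔) (x i) := by
    refine isRsopPart_of_span_eq _ ?_ htcard.symm
    rw [show (fun i => algebraMap S (Localization.AtPrime 𝔔) (x i)) =
      ⇑(algebraMap S (Localization.AtPrime 𝔔)) ∘ x from rfl, Set.range_comp, hspan]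
  obtain ⟨f₁, hf₁, hnhd⟩ := RsopStrataNhd.exists_nhd_of_isRsopPart k ⟨𝔔, inferInstance⟩ x hrsop
  obtain ⟨g₁, hg₁, hsat⟩ :=
    FixedPointSaturation.exists_gradeZero_basicOpen_subset_of_fixed 𝒮 hA 𝔔 hfix f₁ hf₁
  -- brick 3: monomial generation and the contraction property near `𝔔`
  obtain ⟨g₂, hg₂, hgen⟩ :=
    FixedPointMonomialNhd.exists_gradeZero_forall_mul_mem_adjoin_of_fixed 𝒮 hA 𝔔 hfix t htspan
  rw [hrange] at hgen
  obtain ⟨g₃, hg₃, hd⟩ :=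
    FixedPointContraction.exists_gradeZero_forall_mul_mem_span_monomials_of_fixed 𝒮 x a ha hA 𝔔
      hfix hspan
  -- the neighbourhood
  refine ⟨g₁ * (g₂ * g₃), ?_, fun 𝔮' _ hg𝔮' => ?_⟩
  · rw [SetLike.GradeZero.coe_mul, SetLike.GradeZero.coe_mul]
    exact fun h => (‹𝔔.IsPrime›.mem_or_mem h).elim hg₁ fun h' =>
      (‹𝔔.IsPrime›.mem_or_mem h').elim hg₂ hg₃
  -- a prime of `S` over `𝔮'` of the same local dimension
  obtain ⟨𝔔', h𝔔', h𝔔'𝔮, hdim⟩ := GoingUpHeight.exists_liesOver_ringKrullDim_eq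
    (algebraMap_gradeZero_injective 𝒮) 𝔮'
  subst h𝔔'𝔮
  have hgg : ((g₁ * (g₂ * g₃) : 𝒮 0) : S) ∉ 𝔔' := fun h => hg𝔮' (Ideal.mem_comap.mpr h)
  rw [SetLike.GradeZero.coe_mul, SetLike.GradeZero.coe_mul] at hgg
  have hg₁' : (g₁ : S) ∉ 𝔔' := fun h => hgg (𝔔'.mul_mem_right _ h)
  have hg₂₃ : ((g₂ * g₃ : 𝒮 0) : S) ∉ 𝔔' := by
    rw [SetLike.GradeZero.coe_mul]
    exact fun h => hgg (𝔔'.mul_mem_left _ h)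
  have hf₁' : f₁ ∉ 𝔔' := hsat 𝔔' h𝔔' hg₁'
  -- the stratum through `𝔔'`
  set I : Finset (Fin n) := Finset.univ.filter (fun i => x i ∈ 𝔔') with hIdef
  have hI : ∀ i, i ∈ I ↔ x i ∈ 𝔔' := fun i => by simp [hIdef]
  set ys : List S := (List.ofFn x).filter (fun y => decide (y ∈ 𝔔')) with hys
  have hsub : ys.Sublist (List.ofFn x) := List.filter_sublist
  have hys𝔔 : ∀ y ∈ ys, y ∈ 𝔔' := fun y hy => by
    have h := (List.mem_filter.mp hy).2
    simpa using h
  obtain ⟨hreg, -, hdimS⟩ := hnhd ⟨𝔔', h𝔔'⟩ hf₁' ys hsub hys𝔔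
  have hofList : Ideal.ofList ys = Ideal.span (x '' (↑I : Set (Fin n))) :=
    ofList_filter_ofFn_eq x 𝔔' I hI
  have hlen : ys.length = I.card := length_filter_ofFn (· ∈ 𝔔') x
  rw [hofList] at hreg hdimS
  rw [hlen] at hdimS
  -- the single-prime packaging
  exact FixedPointChartLogRegular.isLogRegularAt_chart_of_stratum 𝒮 x a ha φ hφ 𝔔' I hI hA
    (g₂ * g₃) hg₂₃
    (fun s => by
      rw [SetLike.GradeZero.coe_mul, mul_assoc]
      exact hgen _)
    (fun r hr0 hrI => by
      have h := Submodule.smul_mem _ g₂ (hd I r hr0 hrI)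
      rw [Algebra.smul_def] at h
      rw [SetLike.GradeZero.coe_mul, mul_assoc]
      exact h)
    hreg hdimS hdim

end Summit.ResolutionOfSingularities.ResolutionOfSingularities.Theorems.FRationalResolution.FixedPointLogRegularNhd

end
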